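import Summits.Schanuel.Schanuel.Theorems.DiophantineDichotomyKhovanskiiApproxTypeEvRareFieldLWDh
import Summits.Schanuel.Schanuel.Theorems.DiophantineDichotomyKhovanskiiApproxTypeEvRareFieldThreeLayers
import Summits.Schanuel.Schanuel.Theorems.DiophantineDichotomyKhovanskiiApproxTypeEvRareFieldCertificateGame
import HarnessLib

/-!
# Line `rare-field-species` — crux `DiophantineDichotomy.KhovanskiiApproxTypeEv` (stmt-Schanuel-14972)
# SUPPORT SKELETON v3 (lead a4, `prover-line-stmt-Schanuel-14972-a4-0`, 2026-08-17): IMPORT-ONLY,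
# 0 sorries — every registered stub and goal of the line is LANDED

**This file has NO `KhovanskiiApproxTypeEv_of` — by design** (crux-plan verdict `no-skeleton`,
`Lines/rare-field-species.md`): the crux AS FILED is kernel-certified
`⟺ EvNonLWTwo ∧ EvRankThreeUp` (p125111) and `⟹ e ⊥ π ∧ πi ⊥ log 2 ∧ log 2 ⊥ log 3` (p125943), and the
idea `rare-field-species` is NEGATIVE KNOWLEDGE about its naive Lindemann–Weierstrass layer at rank
`≥ 3`; any `_of` cut from it would carry the open layers as stubs (costume).

What the line delivered (all `--supports stmt-Schanuel-14972`, axioms `propext/Classical.choice/Quot.sound`):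

| file (`Theorems/DiophantineDichotomyKhovanskiiApproxTypeEv…`) | content | proposal |
|---|---|---|
| `RareFieldDefs.lean` | vocabulary `EvLW`, `EvNonLWRankThreeUp`, `ApproxTypeDhEvYAt`, `ApproxTypeDhEvAt`, `approxTypeDhEvAt_of_Y`, `EvLWDh`, `EvLWBalanced`, stub statements `LWPointFree`, `DhOfPrimitiveY`, `BalancedOfDhY`, `gameProfile`, `IsAbelianAlgebraic`, `ExpNotAbelianLiouville` | p136201 |
| `RareFieldLWPointFree.lean` | `stub_lwPointFree : LWPointFree` (algebraic points are free Khovanskii points: `gᵢ = minpoly(sᵢ)(zᵢ)`, Jacobian `diag(minpolyᵢ′(sᵢ)) ≠ 0` by separability) | p136499 |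
| `RareFieldDhOfPrimitive.lean` | `stub_dhOfPrimitiveY : DhOfPrimitiveY` (threshold bookkeeping, `H₀(d) = ⌈exp(max d (exp(κ d log(d+2))))⌉₊`, `C' = 2C+1`) | p136545 |
| `RareFieldBalanced.lean` | `stub_balancedOfDhY : BalancedOfDhY` (`m := min_j deg γ(inr j)`, `dˣ ≤ m`) | p136500 |
| `RareFieldLWDh.lean` | goals `evLWDh : EvLWDh` (LW layer in `(d,h)` currency at EVERY rank `n ≥ 1`, exponent `1 + 1/n`, from Ably 1994 `stub_lwPenaltyMeasure` p121092 + `stub_penaltyTransfer` p85905), `evLWBalanced : EvLWBalanced`, the naive corollary `approxTypeEvAt_lw_naive` (`ApproxTypeEvAt n s (1+1/n) 0 C` at every LW point of every rank), window arithmetic | (this seat) |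
| `RareFieldThreeLayers.lean` | goal `khovanskiiApproxTypeEv_iff_threeLayers : KhovanskiiApproxTypeEv ↔ (EvNonLWTwo ∧ (∀ n ≥ 3, EvLW n) ∧ EvNonLWRankThreeUp)`, `evLW_two`, `evLW_two_window` | (this seat) |
| `RareFieldCertificateGame.lean` | certificate game (`certificate_value`, `two_certificate_cap`, `threshold_lt_cap`, `spread_subtuple_certificate`, …) and `abelianChallengers_repelled_of : ExpNotAbelianLiouville → …` | p136514 |

Reading for the tenure planner: the crux as filed has THREE open layers — `EvNonLWTwo` (⊇ `e ⊥ π`),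
`∀ n ≥ 3, EvLW n` (naive-currency LW layer: capped at `(n+1)/(2n) > 1/(n−1)` for every
`(degree, absolute height)`-priced input; RFT-class open; needs a rarity-priced input such as the OPEN
`ExpNotAbelianLiouville`), `EvNonLWRankThreeUp` (⊇ two algebraically independent logarithms) — while in
`(d,h)` currency the LW layer `EvLWDh` is now a THEOREM at every rank (`evLWDh`).  Restate; do not re-line.
At the end of this file the `(d,h)` re-cut is typed in this line's vocabulary (`KhovanskiiApproxTypeDhEvR3`,
NOT filed) together with the proof that its LW layer holds at every rank with room (`a = 1/n < 1/(n−1)`,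
`khovanskiiApproxTypeDhEvR3_lw`).
-/

noncomputable section

-- `Summit.Schanuel.Schanuel.…` is the mandated summit/sub-problem namespace (single-conjunct summit), hence:
set_option linter.dupNamespace false

namespace Summit.Schanuel.Schanuel.Cruxes.KhovanskiiApproxTypeEv.RareFieldSpecies

open Summit.Schanuel.Schanuel.Theses.DiophantineDichotomy (KhovanskiiApproxTypeEv)
open Summit.Schanuel.Schanuel.Cruxes.KhovanskiiApproxType.LwSmallHeight (IsFreeKhovanskii)
open Summit.Schanuel.Schanuel.Cruxes.KhovanskiiApproxTypeEv.AnchoredReduction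
  (EvNonLWTwo EvRankThreeUp)

/-! Registered stubs and goals of the line, all landed (checked by name): -/
example : LWPointFree := stub_lwPointFree
example : DhOfPrimitiveY := stub_dhOfPrimitiveY
example : BalancedOfDhY := stub_balancedOfDhY
example : EvLWDh := evLWDh
example : EvLWBalanced := evLWBalanced
example : KhovanskiiApproxTypeEv ↔ (EvNonLWTwo ∧ (∀ n, 3 ≤ n → EvLW n) ∧ EvNonLWRankThreeUp) :=
  khovanskiiApproxTypeEv_iff_threeLayers

/-- What a concluding composition WOULD need (honest residue = the crux itself, split in three):
the three open layers give the crux back.  This is `khovanskiiApproxTypeEv_iff_threeLayers.2`, stated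
as the line's transfer shape for the record — its hypotheses are open problems, not stubs. -/
theorem khovanskiiApproxTypeEv_of_threeLayers (h₂ : EvNonLWTwo) (hL : ∀ n, 3 ≤ n → EvLW n)
    (hN : EvNonLWRankThreeUp) : KhovanskiiApproxTypeEv :=
  khovanskiiApproxTypeEv_iff_threeLayers.2 ⟨h₂, hL, hN⟩

/-! ## For the tenure planner: the `(d,h)` re-cut typed in this line's vocabulary (NOT filed here —
statement items are the planner's business; this is a checked rendering of restatement input R3) -/

/-- `KhovanskiiApproxTypeDhEvR3` — the `(d,h)`-CURRENCY EVENTUAL CRUX at every free Khovanskii point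
(`n ≥ 2`, `s` linearly independent): `∃ a < 1/(n−1), C > 0` with, eventually in `H`,
`‖γ − θ‖ ≥ exp(−C d^{1+a} log H / m)` for challengers of level `(d, H)` all of whose coordinates have
degree `≥ m` (`ApproxTypeDhEvAt`, all `2n` coordinates charged since `z`-coordinates may be
transcendental).  Shape of `KhovanskiiApproxTypeDhEv` (`Cruxes/KhovanskiiApproxType/SketchIdeator2.lean`)
without the idle `dᵇ` term and with degrees measured by `minpoly`. -/
def KhovanskiiApproxTypeDhEvR3 : Prop :=
  ∀ (n : ℕ) (s : Fin n → ℂ), 2 ≤ n → LinearIndependent ℚ s → IsFreeKhovanskii n s →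
    ∃ a C : ℝ, a < 1 / ((n : ℝ) - 1) ∧ ApproxTypeDhEvAt n s (1 + a) C

/-- **Its Lindemann–Weierstrass layer is a THEOREM at every rank**, with room: `a = 1/n < 1/(n−1)`
(`approxTypeDhEvAt_lw`, from `evLWDh`). -/
theorem khovanskiiApproxTypeDhEvR3_lw (n : ℕ) (s : Fin n → ℂ) (hn : 2 ≤ n)
    (halg : ∀ i, IsAlgebraic ℚ (s i)) (hli : LinearIndependent ℚ s) :
    ∃ a C : ℝ, a < 1 / ((n : ℝ) - 1) ∧ ApproxTypeDhEvAt n s (1 + a) C := by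
  obtain ⟨C, hC⟩ := approxTypeDhEvAt_lw n s (by omega) halg hli
  refine ⟨1 / (n : ℝ), C, ?_, hC⟩
  have h2 : (2 : ℝ) ≤ n := by exact_mod_cast hn
  rw [div_lt_div_iff₀ (by linarith) (by linarith)]
  linarith

end Summit.Schanuel.Schanuel.Cruxes.KhovanskiiApproxTypeEv.RareFieldSpecies

end
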